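import Mathlib.RingTheory.TensorProduct.Maps
import Mathlib.Algebra.MonoidAlgebra.Basic
import Mathlib.LinearAlgebra.Matrix.Charpoly.Coeff
import Mathlib.Topology.Algebra.Ring.Ideal
import Mathlib.RingTheory.Ideal.Quotient.Operations
import Literature.NumberTheory.GaloisRepresentations.GaloisRep
import HarnessLib

/-!
# Chenevier determinants and Hecke-valued Galois determinants (Scholze, Johansson–Newton)

Topic `NumberTheory/GaloisRepresentations`, namespace `Literature.NumberTheory.GaloisRepresentations`.
Definition request `defn-HeckeDeterminantCompletedCohomology` (route `EvenArtinGL4Door`, crux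
`TwoAdicProAutomorphyGL4`; also the natural receptacle for `IsProModular` / completed-cohomology
statements of route `BianchiArtinPoints`).

## 1. Chenevier determinants (`ChenevierDeterminant A R d`)

Let `A` be a commutative ring and `R` an (associative, unital) `A`-algebra.  A **determinant of
dimension `d`** on `R` (Chenevier, §1.2, Definition; Scholze, Def. V.1.8) is a *multiplicative
`A`-polynomial law `D : R → A`, homogeneous of degree `d`*: for every commutative `A`-algebra `S`
a map `D_S : S ⊗[A] R → S`, natural in `S`, with `D_S(1) = 1`, `D_S(xy) = D_S(x) D_S(y)` and
`D_S(s x) = s ^ d D_S(x)` (Roby's polynomial laws, Chenevier §1.1).  When `R = A[G]` is a group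
algebra one speaks of a determinant *of `G`* (`GroupDeterminant A G d`); the basic example is
`det ∘ ρ` for a representation `ρ : G → GL_d(A)` (Chenevier §1.2; Scholze Rem. V.1.9), here
`ChenevierDeterminant.ofAlgHom` / `GroupDeterminant.ofMonoidHom` / `GroupDeterminant.ofFramedRep`.

* `D.charpoly r = D_{A[X]}(X - r)` is Chenevier's characteristic polynomial `χ(r, X)` (§1.3) and
  `D.revCharpoly r = D_{A[X]}(1 - X r)` is Scholze's (Def. V.1.8, "nonstandard convention"); for
  `det ∘ ρ` they are Mathlib's `Matrix.charpoly` and `Matrix.charpolyRev`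
  (`charpoly_ofAlgHom`, `revCharpoly_ofAlgHom`).
* `D.IsContinuous` (topological `A` and `G`): `g ↦ D(1 - X g)` is continuous coefficientwise
  (Scholze Def. V.1.8; equivalently all `Λ_i : G → A` continuous, Chenevier §2.5, by Amitsur's
  formula); `det ∘ ρ` of a continuous framed representation is continuous
  (`GroupDeterminant.isContinuous_ofFramedRep`).

*Formalisation notes.*  (i) Mathlib's `PolynomialLaw` quantifies over commutative **semi**rings
`S`; over those `Matrix.det` (needed for `det ∘ ρ`) does not exist, so we quantify over
commutative rings `S` with `Algebra A S`, which for a commutative *ring* `A` is exactly Roby's and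
Chenevier's category `𝒞_A` of commutative `A`-algebras; as in Mathlib the test algebras live in
the universe of `A`.  (ii) The target functor `S ↦ A ⊗[A] S` is written as `S ↦ S`.
(iii) Nothing beyond the definitions and the example `det ∘ ρ` is claimed: Amitsur's formula,
uniqueness from characteristic polynomials, kernels and Chenevier's structure theorems
(§§1.3–2) are not vendored here.

## 2. Galois determinants and Frobenius (`GaloisDeterminant F A d`)

For a field `F`, `GaloisDeterminant F A d := GroupDeterminant A (Field.absoluteGaloisGroup F) d`.
In the idiom of the tree's `GaloisRep.HasFrobCharpolyAt` (all primes `𝔓 ∣ v` of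
`absIntegers (𝓞 F) F`, all Frobenius elements at `𝔓`, hence whole inertia cosets):
`D.HasGeomFrobRevCharpolyAt v P` says `D(1 - X σ) = P` for every **geometric** Frobenius `σ` at
every `𝔓 ∣ v` (`Literature.NumberTheory.GaloisRepresentations.IsGeomFrobAt`) — the shape
`D(1 - X Frob_v) = P_v(X)` printed by Scholze (Thm. V.4.1, with `Frob_v` geometric, §V.1) and
Johansson–Newton (Thm. B); `D.HasFrobCharpolyAt v P` is the arithmetic-Frobenius /
`det(X - ·)` variant matching `FramedGaloisRep.HasFrobCharpolyAt`
(`hasFrobCharpolyAt_ofFramedRep_iff`); `D.IsUnramifiedAt v` records that the characteristic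
polynomials `D(1 - X g)` are invariant under right translation by every inertia group `I_𝔓`,
`𝔓 ∣ v` — the property a determinant of `G_{F,S}` (Galois group of the maximal extension
unramified outside `S`) acquires at `v ∉ S` when pulled back to `Γ_F`
(`isUnramifiedAt_ofFramedRep` for `det ∘ ρ`, `ρ` unramified).

## 3. Hecke determinants modulo a nilpotent ideal (`HeckeDeterminantCompletedCohomology`)

The requested notion.  Scholze (Thm. V.4.1) proves: for `F` totally real or CM, `n ≥ 1`, `p`,
`S ⊇ {v ∣ p} ∪ {ramified}` and any level `K = K_S K^S`, weight `ξ`, degree `i` and `m ≥ 1`, with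
`𝕋 = 𝕋_{F,S}(K, ξ, i, m)` the image of the spherical Hecke algebra in
`End(H^i(X_K, ℳ_{ξ,K}/p^m))`, there are an ideal `I ⊆ 𝕋` with `I ^ N = 0`, `N = N([F:ℚ], n)`,
and an `n`-dimensional continuous determinant `D` of `G_{F,S}` with values in `𝕋 / I` such that
`D(1 - X Frob_v) = P_v(X) := 1 - q_v^{(n+1)/2} T_{1,v} X + q_v^{2(n+1)/2} T_{2,v} X² - ⋯
+ (-1)^n q_v^{n(n+1)/2} T_{n,v} X^n` for all `v ∉ S` (Cor. V.4.4: an actual representation into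
`GL_n(𝕋_𝔪 / I)` for non-Eisenstein `𝔪`); Johansson–Newton (Thm. B, Cor. 5.3.2) glue this over
the (extended) eigenvariety / the compact big Hecke algebra `\hat 𝕋` with a **closed** ideal
`I`, `I ^ M = 0`.  The common shape — *a topological ring `T`, Hecke polynomials
`P : v ↦ P_v ∈ T[X]`, an exceptional set `S`, a nilpotence bound `N`, and the datum
`(I, I ^ N = 0, D : GaloisDeterminant F (T ⧸ I) n continuous, D(1 - X Frob_v) ≡ P_v mod I ∀ v ∉ S)`*
— is `HeckeDeterminantCompletedCohomology F n N S T P` (data) / `HasHeckeDeterminant` (Prop);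
`scholzeHeckePolynomial n c` builds `P_v` from the integral coefficients
`c_i = q_v^{i(n+1)/2} T_{i,v}`.  The sources (Scholze Thm. V.4.1, Cor. V.4.2–4; Johansson–Newton
Thm. 5.3.1, Cor. 5.3.2) produce a determinant of `G_{F,S}`; the tree has no `G_{F,S}` type, so the
notion is stated over `Γ_F` with the unramified-outside-`S` clause recorded as a field
(`isUnramifiedAt`, inertia-coset invariance of the characteristic polynomials at every `v ∉ S`)
next to the Frobenius identity on whole Frobenius cosets — i.e. a determinant of `G_{F,S}` pulled
back to `Γ_F`.

**What is NOT here.**  The completed cohomology `H̃^•(K^p)` of `GL_n/F` and its big Hecke algebra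
`𝕋(K^p)_𝔪` are the subject of the separate request `defn-CompletedCohomology`; the *instances*
"`𝕋_{F,S}(K,ξ,i,m)` (Scholze Thm. V.4.1), `𝕋(K^p)_𝔪` for non-Eisenstein `𝔪` (Cor. V.4.4 and the
limit argument of Cor. V.4.2's proof / Johansson–Newton Cor. 5.3.2), `𝒪^+(𝒳^{red})`
(Johansson–Newton Thm. B) carry a `HeckeDeterminantCompletedCohomology`" are named facts to be
stated in that vocabulary once it lands; they are deliberately not vendored here as facts about an
abstract `T` (which would be vacuous or false).

## References

* G. Chenevier, *The p-adic analytic space of pseudocharacters of a profinite group and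
  pseudorepresentations over arbitrary rings*, LMS LNS 414 (2014), §1.1–§1.3, §2.5
  (arXiv:0809.0415) [Chenevier2014Determinants].
* P. Scholze, *On torsion in the cohomology of locally symmetric varieties*, Ann. of Math. 182
  (2015), Def. V.1.8, Rem. V.1.9, Thm. V.4.1, Cor. V.4.2–V.4.4 (arXiv:1306.2070) [Scholze2015].
* C. Johansson, J. Newton, *Extended eigenvarieties for overconvergent cohomology*, Algebra
  Number Theory 13 (2019), Thm. B, Thm. 5.3.1, Cor. 5.3.2 (arXiv:1604.07739) [JohanssonNewton2019].
* G. Shimura, *Introduction to the arithmetic theory of automorphic functions* (1971), Thm. 3.21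
  (Satake normalisation `T_v^{(i)} ↔ q^{i(n-i)/2} e_i`) [ShimuraIATAF1971].
-/

noncomputable section

open scoped TensorProduct Polynomial NumberField
open Field IsDedekindDomain

namespace Literature.NumberTheory.GaloisRepresentations

universe u v w

/-! ## 1. Chenevier determinants -/

/-- A **determinant of dimension `d`** on the `A`-algebra `R` in the sense of Chenevier: a
multiplicative `A`-polynomial law `R → A` which is homogeneous of degree `d`, i.e. for every
commutative `A`-algebra `S` (in the universe of `A`) a map `D_S : S ⊗[A] R → S`, natural in `S`
(`map_toFun`), with `D_S 1 = 1`, `D_S (x * y) = D_S x * D_S y` and `D_S (s • x) = s ^ d * D_S x`.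
Chenevier, §1.1 (polynomial laws, homogeneity, multiplicativity) and §1.2, Definition; Scholze,
Def. V.1.8.  See the module docstring, note (i), for the comparison with Mathlib's `PolynomialLaw`.
[cite: Chenevier2014Determinants, §1.2 Definition] [cite: Scholze2015, Def. V.1.8] -/
structure ChenevierDeterminant (A : Type u) [CommRing A] (R : Type v) [Ring R] [Algebra A R]
    (d : ℕ) where
  /-- The maps `D_S : S ⊗[A] R → S`, one for each commutative `A`-algebra `S : Type u`. -/
  toFun (S : Type u) [CommRing S] [Algebra A S] : S ⊗[A] R → S
  /-- Naturality in `S` (a polynomial law): `φ (D_S x) = D_{S'} ((φ ⊗ id) x)`. -/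
  map_toFun {S : Type u} [CommRing S] [Algebra A S] {S' : Type u} [CommRing S'] [Algebra A S']
    (φ : S →ₐ[A] S') (x : S ⊗[A] R) :
    φ (toFun S x) = toFun S' (Algebra.TensorProduct.map φ (AlgHom.id A R) x)
  /-- Multiplicativity, unit. -/
  toFun_one (S : Type u) [CommRing S] [Algebra A S] : toFun S 1 = 1
  /-- Multiplicativity. -/
  toFun_mul (S : Type u) [CommRing S] [Algebra A S] (x y : S ⊗[A] R) :
    toFun S (x * y) = toFun S x * toFun S y
  /-- Homogeneity of degree `d`. -/
  toFun_smul (S : Type u) [CommRing S] [Algebra A S] (s : S) (x : S ⊗[A] R) :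
    toFun S (s • x) = s ^ d * toFun S x

namespace ChenevierDeterminant

variable {A : Type u} [CommRing A] {R : Type v} [Ring R] [Algebra A R] {d : ℕ}

attribute [simp] toFun_one toFun_mul

/-- Two determinants with the same maps `D_S` are equal. [folklore] -/
@[ext]
theorem ext {D D' : ChenevierDeterminant A R d} (h : ∀ (S : Type u) [CommRing S] [Algebra A S]
    (x : S ⊗[A] R), D.toFun S x = D'.toFun S x) : D = D' := by
  cases D; cases D'; congr; funext S _ _ x; exact h S x

/-- The **ground map** `D_A : R → A`, `r ↦ D_A (1 ⊗ r)` (Chenevier §1.1: `P_A`; §1.3: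
`Λ_d = D`).  [cite: Chenevier2014Determinants, §1.3] -/
def ground (D : ChenevierDeterminant A R d) (r : R) : A := D.toFun A (1 ⊗ₜ r)

/-- The ground map is multiplicative and unital: `D_A` as a monoid homomorphism `R →* A`.
[cite: Chenevier2014Determinants, §1.1] -/
def groundMonoidHom (D : ChenevierDeterminant A R d) : R →* A where
  toFun := D.ground
  map_one' := by simp [ground, ← Algebra.TensorProduct.one_def]
  map_mul' x y := by
    simp only [ground]
    rw [← D.toFun_mul, Algebra.TensorProduct.tmul_mul_tmul, one_mul]

/-- Unfolding lemma for `groundMonoidHom`. [folklore] -/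
@[simp] lemma groundMonoidHom_apply (D : ChenevierDeterminant A R d) (r : R) :
    D.groundMonoidHom r = D.ground r := rfl

/-- Homogeneity on the ground ring: `D_A(a r) = a ^ d D_A(r)`. [cite: Chenevier2014Determinants, §1.1] -/
lemma ground_smul (D : ChenevierDeterminant A R d) (a : A) (r : R) :
    D.ground (a • r) = a ^ d * D.ground r := by
  simp only [ground]
  rw [← D.toFun_smul, TensorProduct.smul_tmul', TensorProduct.smul_tmul]

/-- Chenevier's **characteristic polynomial** `χ(r, X) = D_{A[X]}(X - r) ∈ A[X]` of `r ∈ R`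
(standard convention `det(X - r)`; its coefficients are the `(-1)^i Λ_i(r)`).
[cite: Chenevier2014Determinants, §1.3] -/
def charpoly (D : ChenevierDeterminant A R d) (r : R) : A[X] :=
  D.toFun A[X] ((Polynomial.X : A[X]) ⊗ₜ (1 : R) - (1 : A[X]) ⊗ₜ r)

/-- Scholze's **reverse characteristic polynomial** `D_{A[X]}(1 - X r) ∈ A[X]` of `r ∈ R`
("nonstandard convention" `det(1 - X r)`).  [cite: Scholze2015, Def. V.1.8] -/
def revCharpoly (D : ChenevierDeterminant A R d) (r : R) : A[X] :=
  D.toFun A[X] (1 - (Polynomial.X : A[X]) ⊗ₜ r)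

/-! ### The determinant `det ∘ ρ` of a matrix representation -/

section OfAlgHom

variable (ρ : R →ₐ[A] Matrix (Fin d) (Fin d) A)

/-- Base change of `ρ : R → M_d(A)` to a commutative `A`-algebra `S`: the `S`-algebra map
`S ⊗[A] R → M_d(S)`, `s ⊗ r ↦ s · ρ(r)`. [folklore] -/
def baseChangeMatrix (S : Type w) [CommRing S] [Algebra A S] :
    S ⊗[A] R →ₐ[S] Matrix (Fin d) (Fin d) S :=
  Algebra.TensorProduct.lift (Algebra.ofId S (Matrix (Fin d) (Fin d) S))
    ((Algebra.ofId A S).mapMatrix.comp ρ) (fun s _ => Algebra.commutes s _)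

/-- `baseChangeMatrix` on pure tensors. [folklore] -/
@[simp] lemma baseChangeMatrix_tmul (S : Type w) [CommRing S] [Algebra A S] (s : S) (r : R) :
    baseChangeMatrix ρ S (s ⊗ₜ r) = s • (ρ r).map (algebraMap A S) := by
  rw [baseChangeMatrix, Algebra.TensorProduct.lift_tmul, Algebra.ofId_apply, ← Algebra.smul_def]
  rfl

/-- Naturality of `baseChangeMatrix` in `S`. [folklore] -/
lemma mapMatrix_baseChangeMatrix {S : Type w} [CommRing S] [Algebra A S] {S' : Type*} [CommRing S']
    [Algebra A S'] (φ : S →ₐ[A] S') (x : S ⊗[A] R) :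
    φ.mapMatrix (baseChangeMatrix ρ S x) =
      baseChangeMatrix ρ S' (Algebra.TensorProduct.map φ (AlgHom.id A R) x) := by
  induction x using TensorProduct.induction_on with
  | zero => simp
  | tmul s r =>
    rw [Algebra.TensorProduct.map_tmul, baseChangeMatrix_tmul, AlgHom.id_apply,
      baseChangeMatrix_tmul]
    ext i j
    simp [Matrix.smul_apply, Matrix.map_apply]
  | add x y hx hy => simp [map_add, hx, hy]

/-- **The determinant of a matrix representation** `ρ : R → M_d(A)`: `D_S = det ∘ ρ_S` where
`ρ_S : S ⊗[A] R → M_d(S)` is the base change — a determinant of dimension `d`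
(Chenevier, §1.2, "`Det := det ∘ ρ`"; Scholze, Rem. V.1.9).
[cite: Chenevier2014Determinants, §1.2] [cite: Scholze2015, Rem. V.1.9] -/
def ofAlgHom : ChenevierDeterminant A R d where
  toFun S _ _ x := (baseChangeMatrix ρ S x).det
  map_toFun φ x := by rw [AlgHom.map_det, mapMatrix_baseChangeMatrix]
  toFun_one S _ _ := by simp
  toFun_mul S _ _ x y := by simp [Matrix.det_mul]
  toFun_smul S _ _ s x := by rw [map_smul, Matrix.det_smul, Fintype.card_fin]

/-- Unfolding lemma for `ofAlgHom`. [folklore] -/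
@[simp] lemma ofAlgHom_toFun (S : Type u) [CommRing S] [Algebra A S] (x : S ⊗[A] R) :
    (ofAlgHom ρ).toFun S x = (baseChangeMatrix ρ S x).det := rfl

/-- The ground map of `det ∘ ρ` is `r ↦ det (ρ r)`. [cite: Chenevier2014Determinants, §1.2] -/
@[simp] lemma ground_ofAlgHom (r : R) : (ofAlgHom ρ).ground r = (ρ r).det := by
  simp [ground, Matrix.map_id]

/-- For `det ∘ ρ`, Chenevier's characteristic polynomial of `r` is `det(X - ρ r)`
(Mathlib `Matrix.charpoly`): "the two notions of characteristic polynomials obviously agree".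
[cite: Scholze2015, Rem. V.1.9] -/
lemma charpoly_ofAlgHom (r : R) : (ofAlgHom ρ).charpoly r = (ρ r).charpoly := by
  simp only [charpoly, ofAlgHom_toFun, map_sub, baseChangeMatrix_tmul, one_smul,
    Matrix.charpoly, Matrix.charmatrix, Polynomial.algebraMap_eq]
  congr 1
  rw [Matrix.scalar_apply, map_one, RingHom.mapMatrix_apply]
  ext i j
  by_cases h : i = j <;> simp [h, Matrix.diagonal]

/-- For `det ∘ ρ`, Scholze's reverse characteristic polynomial of `r` is `det(1 - X ρ r)`
(Mathlib `Matrix.charpolyRev`).  [cite: Scholze2015, Def. V.1.8] -/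
lemma revCharpoly_ofAlgHom (r : R) : (ofAlgHom ρ).revCharpoly r = (ρ r).charpolyRev := by
  simp only [revCharpoly, ofAlgHom_toFun, map_sub, map_one, baseChangeMatrix_tmul,
    Matrix.charpolyRev, Polynomial.algebraMap_eq]

end OfAlgHom

/-! ### Continuity -/

section Continuous

variable {G : Type w} [Monoid G] [TopologicalSpace G] [TopologicalSpace A]

/-- A determinant `D` of the topological monoid/group `G` with values in the topological ring `A`
is **continuous** if the map `G → A[X]`, `g ↦ D(1 - X g)`, is continuous for the coefficientwise
topology (Scholze, Def. V.1.8); equivalently (Amitsur's formula) all coefficient functions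
`Λ_i : G → A` of `D(X - g)` are continuous, which is Chenevier's definition (§2.5).
[cite: Scholze2015, Def. V.1.8] [cite: Chenevier2014Determinants, §2.5] -/
def IsContinuous (D : ChenevierDeterminant A (MonoidAlgebra A G) d) : Prop :=
  ∀ i : ℕ, Continuous fun g : G => (D.revCharpoly (MonoidAlgebra.of A G g)).coeff i

end Continuous

end ChenevierDeterminant

/-! ### Determinants of monoids / groups and of framed representations -/

/-- A **determinant of dimension `d` of the monoid (group) `G` over `A`**: a `d`-dimensional
determinant on the monoid algebra `A[G]` (Chenevier, §1.2: "when `R = A[G]` … we say also that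
`D` is a determinant on `G`"). [cite: Chenevier2014Determinants, §1.2] -/
abbrev GroupDeterminant (A : Type u) [CommRing A] (G : Type w) [Monoid G] (d : ℕ) :=
  ChenevierDeterminant A (MonoidAlgebra A G) d

namespace GroupDeterminant

variable {A : Type u} [CommRing A] {G : Type w} {d : ℕ}

section Monoid

variable [Monoid G]

/-- The determinant `det ∘ ρ` of a matrix-valued monoid homomorphism `ρ : G →* M_d(A)`, through
the algebra map `A[G] → M_d(A)` (Mathlib `MonoidAlgebra.lift`).
[cite: Chenevier2014Determinants, §1.2] [cite: Scholze2015, Rem. V.1.9] -/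
def ofMonoidHom (ρ : G →* Matrix (Fin d) (Fin d) A) : GroupDeterminant A G d :=
  ChenevierDeterminant.ofAlgHom (MonoidAlgebra.lift A (Matrix (Fin d) (Fin d) A) G ρ)

/-- Characteristic polynomial of a group element for `det ∘ ρ`: `det(X - ρ g)`.
[cite: Scholze2015, Rem. V.1.9] -/
lemma charpoly_ofMonoidHom_of (ρ : G →* Matrix (Fin d) (Fin d) A) (g : G) :
    (ofMonoidHom ρ).charpoly (MonoidAlgebra.of A G g) = (ρ g).charpoly := by
  rw [ofMonoidHom, ChenevierDeterminant.charpoly_ofAlgHom, MonoidAlgebra.lift_of]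

/-- Reverse characteristic polynomial of a group element for `det ∘ ρ`: `det(1 - X ρ g)`.
[cite: Scholze2015, Def. V.1.8] -/
lemma revCharpoly_ofMonoidHom_of (ρ : G →* Matrix (Fin d) (Fin d) A) (g : G) :
    (ofMonoidHom ρ).revCharpoly (MonoidAlgebra.of A G g) = (ρ g).charpolyRev := by
  rw [ofMonoidHom, ChenevierDeterminant.revCharpoly_ofAlgHom, MonoidAlgebra.lift_of]

/-- The ground map of `det ∘ ρ` at a group element is `det (ρ g)`.
[cite: Chenevier2014Determinants, §1.2] -/
lemma ground_ofMonoidHom_of (ρ : G →* Matrix (Fin d) (Fin d) A) (g : G) :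
    (ofMonoidHom ρ).ground (MonoidAlgebra.of A G g) = (ρ g).det := by
  rw [ofMonoidHom, ChenevierDeterminant.ground_ofAlgHom, MonoidAlgebra.lift_of]

end Monoid

section Group

variable [Group G] [TopologicalSpace G] [TopologicalSpace A]

/-- The determinant `det ∘ ρ` of a framed continuous representation `ρ : G →ₜ* GL_d(A)`
(`Literature.NumberTheory.GaloisRepresentations.FramedRep`).
[cite: Chenevier2014Determinants, §1.2] [cite: Scholze2015, Rem. V.1.9] -/
def ofFramedRep (ρ : FramedRep G A d) : GroupDeterminant A G d :=
  ofMonoidHom ((Units.coeHom (Matrix (Fin d) (Fin d) A)).comp ρ.toMonoidHom)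

/-- `det ∘ ρ` has characteristic polynomials `FramedRep.charpoly ρ`. [cite: Scholze2015, Rem. V.1.9] -/
lemma charpoly_ofFramedRep_of (ρ : FramedRep G A d) (g : G) :
    (ofFramedRep ρ).charpoly (MonoidAlgebra.of A G g) = FramedRep.charpoly ρ g := by
  rw [ofFramedRep, charpoly_ofMonoidHom_of]; rfl

/-- `det ∘ ρ` has reverse characteristic polynomials `Matrix.charpolyRev (ρ g)`.
[cite: Scholze2015, Def. V.1.8] -/
lemma revCharpoly_ofFramedRep_of (ρ : FramedRep G A d) (g : G) :
    (ofFramedRep ρ).revCharpoly (MonoidAlgebra.of A G g) =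
      ((ρ g : GL (Fin d) A) : Matrix (Fin d) (Fin d) A).charpolyRev := by
  rw [ofFramedRep, revCharpoly_ofMonoidHom_of]; rfl

/-! #### Continuity of `det ∘ ρ` -/

section CoeffContinuous

variable {X : Type*} [TopologicalSpace X] {B : Type*} [CommRing B] [TopologicalSpace B]
  [IsTopologicalRing B]

/-- Auxiliary: all coefficients of `x ↦ p x * q x` depend continuously on `x` if those of `p` and
`q` do (`Polynomial.coeff_mul` is a finite sum). [folklore] -/
private lemma continuous_coeff_mul {p q : X → B[X]} (hp : ∀ k, Continuous fun x => (p x).coeff k)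
    (hq : ∀ k, Continuous fun x => (q x).coeff k) (k : ℕ) :
    Continuous fun x => (p x * q x).coeff k := by
  simp only [Polynomial.coeff_mul]
  exact continuous_finsetSum _ fun a _ => (hp a.1).mul (hq a.2)

/-- Auxiliary: coefficients of a finite product depend continuously on the parameter if those of
the factors do. [folklore] -/
private lemma continuous_coeff_prod {ι : Type*} (s : Finset ι) {p : ι → X → B[X]}
    (hp : ∀ i ∈ s, ∀ k, Continuous fun x => (p i x).coeff k) (k : ℕ) :
    Continuous fun x => (∏ i ∈ s, p i x).coeff k := by
  classical
  induction s using Finset.induction_on generalizing k with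
  | empty =>
    simp only [Finset.prod_empty, Polynomial.coeff_one]
    exact continuous_const
  | insert a s ha ih =>
    simp only [Finset.prod_insert ha]
    exact continuous_coeff_mul (hp a (Finset.mem_insert_self a s))
      (fun k => ih (fun i hi => hp i (Finset.mem_insert_of_mem hi)) k) k

/-- Auxiliary: the coefficients of `det (1 - X • M x)` (`Matrix.charpolyRev`) depend continuously
on `x` when the matrix entries `M x i j ∈ B` do (Leibniz expansion `Matrix.det_apply'`).
[folklore] -/
private lemma continuous_coeff_charpolyRev {m : Type*} [Fintype m] [DecidableEq m]
    {M : X → Matrix m m B} (hM : ∀ i j, Continuous fun x => M x i j) (k : ℕ) :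
    Continuous fun x => (M x).charpolyRev.coeff k := by
  simp only [Matrix.charpolyRev, Matrix.det_apply', Polynomial.finsetSum_coeff,
    Polynomial.coeff_intCast_mul]
  refine continuous_finsetSum _ fun σ _ => continuous_const.mul ?_
  refine continuous_coeff_prod _ (fun i _ k => ?_) k
  simp only [Matrix.sub_apply, Matrix.smul_apply, Matrix.map_apply, Polynomial.coeff_sub,
    smul_eq_mul, Polynomial.X_mul_C, Polynomial.coeff_C_mul_X]
  refine Continuous.sub ?_ ?_
  · simp only [Matrix.one_apply, apply_ite (fun p : B[X] => p.coeff k), Polynomial.coeff_one,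
      Polynomial.coeff_zero]
    exact continuous_const
  · split_ifs
    · exact hM _ _
    · exact continuous_const

end CoeffContinuous

/-- **`det ∘ ρ` of a continuous framed representation is a continuous determinant** (Scholze,
Rem. V.1.9: "if `ρ` is a (continuous) representation, then `D = det ∘ ρ` defines a (continuous)
determinant"): the coefficients of `det(1 - X ρ(g))` are polynomials in the entries of `ρ(g)`.
[cite: Scholze2015, Rem. V.1.9] -/
theorem isContinuous_ofFramedRep [IsTopologicalRing A] (ρ : FramedRep G A d) :
    (ofFramedRep ρ).IsContinuous := by
  intro k
  simp only [revCharpoly_ofFramedRep_of]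
  exact continuous_coeff_charpolyRev
    (fun i j => (Units.continuous_val.comp (map_continuous ρ)).matrix_elem i j) k

end Group

end GroupDeterminant

/-! ## 2. Galois determinants and Frobenius elements -/

/-- A **Galois determinant** of dimension `d` of the field `F` with values in `A`: a determinant
of the absolute Galois group `Γ_F = Field.absoluteGaloisGroup F` over `A` (Chenevier determinant
on `A[Γ_F]`), the determinant-analogue of the tree's `FramedGaloisRep F A d`.
[cite: Chenevier2014Determinants, §1.2] [cite: Scholze2015, Def. V.1.8] -/
abbrev GaloisDeterminant (F : Type u) [Field F] (A : Type v) [CommRing A] (d : ℕ) :=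
  GroupDeterminant A (absoluteGaloisGroup F) d

namespace GaloisDeterminant

variable {F : Type u} [Field F] {A : Type v} [CommRing A] {d : ℕ}

/-- `D.HasGeomFrobRevCharpolyAt v P`: **`D(1 - X Frob_v) = P`** — for every prime `𝔓` of
`\bar ℤ_F = absIntegers (𝓞 F) F` above the finite place `v` and every **geometric** Frobenius
`σ ∈ Γ_F` at `𝔓` (`IsGeomFrobAt (𝓞 F) σ 𝔓`, i.e. `σ⁻¹ x ≡ x ^ {q_v} mod 𝔓`; this ranges over
whole inertia cosets), Scholze's reverse characteristic polynomial `D_{A[X]}(1 - X σ)` equals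
`P`.  This is the printed shape of Scholze, Thm. V.4.1 / Cor. V.4.3–4 (`Frob_v` geometric,
§V.1) and Johansson–Newton, Thm. B, in the idiom of `GaloisRep.HasFrobCharpolyAt`.
[cite: Scholze2015, Thm. V.4.1] [cite: JohanssonNewton2019, Thm. B] -/
def HasGeomFrobRevCharpolyAt (v : HeightOneSpectrum (𝓞 F)) (P : A[X])
    (D : GaloisDeterminant F A d) : Prop :=
  ∀ 𝔓 ∈ v.primesAbove, ∀ σ : absoluteGaloisGroup F, IsGeomFrobAt (𝓞 F) σ 𝔓 →
    D.revCharpoly (MonoidAlgebra.of A _ σ) = P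

/-- `D.HasFrobCharpolyAt v P`: for every prime `𝔓 ∣ v` of `\bar ℤ_F` and every **arithmetic**
Frobenius `σ` at `𝔓` (Mathlib `IsArithFrobAt`), Chenevier's characteristic polynomial
`D_{A[X]}(X - σ)` equals `P` — the determinant analogue of the tree's
`FramedGaloisRep.HasFrobCharpolyAt` (arithmetic Frobenius, `det(X - ·)`, OUTLINE §1 convention),
see `hasFrobCharpolyAt_ofFramedRep_iff`.
Ref: Serre, *Abelian ℓ-adic representations* (1968), Ch. I §2.1, §2.3. [folklore] -/
def HasFrobCharpolyAt (v : HeightOneSpectrum (𝓞 F)) (P : A[X]) (D : GaloisDeterminant F A d) :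
    Prop :=
  ∀ 𝔓 ∈ v.primesAbove, ∀ σ : absoluteGaloisGroup F, IsArithFrobAt (𝓞 F) σ 𝔓 →
    D.charpoly (MonoidAlgebra.of A _ σ) = P

/-- `D` is **unramified at `v`** in the characteristic-polynomial sense: `D(1 - X g σ) = D(1 - X g)`
for all `g ∈ Γ_F` and all `σ` in every inertia group `I_𝔓`, `𝔓 ∣ v`.  A determinant of `G_{F,S}`
(Galois group of the maximal extension unramified outside `S`, as in Scholze Thm. V.4.1) pulled
back along `Γ_F ↠ G_{F,S}` has this property at every `v ∉ S` (inertia at `v` dies in `G_{F,S}`);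
for `D = det ∘ ρ` with `ρ` unramified at `v` it holds by `isUnramifiedAt_ofFramedRep`; by
Amitsur's formula the characteristic polynomials determine `D` (Chenevier §1.3).
Ref: Serre, *Abelian ℓ-adic representations* (1968), Ch. I §2.1 (unramified: inertia acts
trivially). [folklore] -/
def IsUnramifiedAt (v : HeightOneSpectrum (𝓞 F)) (D : GaloisDeterminant F A d) : Prop :=
  ∀ 𝔓 ∈ v.primesAbove, ∀ σ ∈ 𝔓.inertia (absoluteGaloisGroup F), ∀ g : absoluteGaloisGroup F,
    D.revCharpoly (MonoidAlgebra.of A _ (g * σ)) = D.revCharpoly (MonoidAlgebra.of A _ g)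

variable [TopologicalSpace A]

/-- For `D = det ∘ ρ`, `ρ : Γ_F →ₜ* GL_d(A)` framed, `D.HasFrobCharpolyAt v P` is literally the
tree's `FramedGaloisRep.HasFrobCharpolyAt v P ρ`. [folklore] -/
theorem hasFrobCharpolyAt_ofFramedRep_iff (v : HeightOneSpectrum (𝓞 F)) (P : A[X])
    (ρ : FramedGaloisRep F A d) :
    HasFrobCharpolyAt v P (GroupDeterminant.ofFramedRep ρ) ↔ ρ.HasFrobCharpolyAt v P := by
  refine forall₂_congr fun 𝔓 _ => forall₂_congr fun σ _ => ?_
  rw [GroupDeterminant.charpoly_ofFramedRep_of]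

/-- For `D = det ∘ ρ`, `D.HasGeomFrobRevCharpolyAt v P` says `det(1 - X ρ(σ)) = P` for all geometric
Frobenii `σ` at primes above `v`. [folklore] -/
theorem hasGeomFrobRevCharpolyAt_ofFramedRep_iff (v : HeightOneSpectrum (𝓞 F)) (P : A[X])
    (ρ : FramedGaloisRep F A d) :
    HasGeomFrobRevCharpolyAt v P (GroupDeterminant.ofFramedRep ρ) ↔
      ∀ 𝔓 ∈ v.primesAbove, ∀ σ : absoluteGaloisGroup F, IsGeomFrobAt (𝓞 F) σ 𝔓 →
        ((ρ σ : GL (Fin d) A) : Matrix (Fin d) (Fin d) A).charpolyRev = P := by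
  refine forall₂_congr fun 𝔓 _ => forall₂_congr fun σ _ => ?_
  rw [GroupDeterminant.revCharpoly_ofFramedRep_of]

/-- If the framed representation `ρ` is unramified at `v` (`FramedGaloisRep.IsUnramifiedAt`:
inertia maps to `1`), then `det ∘ ρ` is unramified at `v` in the characteristic-polynomial sense.
[folklore] -/
theorem isUnramifiedAt_ofFramedRep {v : HeightOneSpectrum (𝓞 F)} {ρ : FramedGaloisRep F A d}
    (h : ρ.IsUnramifiedAt v) : IsUnramifiedAt v (GroupDeterminant.ofFramedRep ρ) := by
  intro 𝔓 h𝔓 σ hσ g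
  rw [GroupDeterminant.revCharpoly_ofFramedRep_of, GroupDeterminant.revCharpoly_ofFramedRep_of,
    map_mul, h 𝔓 h𝔓 σ hσ, mul_one]

end GaloisDeterminant

/-! ## 3. Hecke determinants modulo a nilpotent ideal -/

section Hecke

/-- **Scholze's Hecke polynomial** at an unramified place from its integral coefficients:
`P_v(X) = 1 - c_1 X + c_2 X² - ⋯ + (-1)^n c_n X^n` where, for `GL_n` over `F` and `v ∉ S`,
`c_i = q_v^{i(n+1)/2} T_{i,v} ∈ 𝕋_v = ℤ_p[GL_n(F_v) // GL_n(𝒪_{F_v})]`, `T_{i,v}` the `i`-th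
elementary symmetric function of the Satake variables (Scholze, §V.4, display before Thm. V.4.1;
Johansson–Newton (5.3)).  In terms of the double-coset operators
`T_v^{(i)} = [GL_n(𝒪_v) diag(ϖ_v^{(i)}, 1^{(n-i)}) GL_n(𝒪_v)] ↔ q_v^{i(n-i)/2} T_{i,v}` (Shimura,
Thm. 3.21; the tree's `Automorphic.heckePolynomial_eq_satakePolynomial`) this is
`c_i = q_v^{i(i+1)/2} T_v^{(i)}`.  Only `c 1, …, c n` are used; the constant term is `1`.
[cite: Scholze2015, Thm. V.4.1] [cite: ShimuraIATAF1971, Theorem 3.21] -/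
def scholzeHeckePolynomial {T : Type v} [CommRing T] (n : ℕ) (c : ℕ → T) : T[X] :=
  1 + ∑ i ∈ Finset.range n, Polynomial.C ((-1) ^ (i + 1) * c (i + 1)) * Polynomial.X ^ (i + 1)

/-- The constant coefficient of Scholze's Hecke polynomial is `1`. [folklore] -/
@[simp] lemma coeff_zero_scholzeHeckePolynomial {T : Type v} [CommRing T] (n : ℕ) (c : ℕ → T) :
    (scholzeHeckePolynomial n c).coeff 0 = 1 := by
  simp [scholzeHeckePolynomial]

/-- The `i`-th coefficient (`1 ≤ i ≤ n`) of Scholze's Hecke polynomial is `(-1)^i c_i`. [folklore] -/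
lemma coeff_scholzeHeckePolynomial {T : Type v} [CommRing T] (n : ℕ) (c : ℕ → T) {i : ℕ}
    (hi : 1 ≤ i) (hin : i ≤ n) : (scholzeHeckePolynomial n c).coeff i = (-1) ^ i * c i := by
  obtain ⟨j, rfl⟩ : ∃ j, i = j + 1 := ⟨i - 1, by omega⟩
  simp only [scholzeHeckePolynomial, Polynomial.coeff_add, Polynomial.coeff_one,
    Nat.succ_ne_zero, if_false, zero_add, Polynomial.finsetSum_coeff, Polynomial.coeff_C_mul,
    Polynomial.coeff_X_pow]
  rw [Finset.sum_eq_single j]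
  · simp
  · intro b _ hb; simp [Ne.symm hb]
  · intro hj; exact absurd (Finset.mem_range.mpr (by omega)) hj

/-- **Hecke-valued Galois determinant modulo a nilpotent ideal** — the notion
`HeckeDeterminantCompletedCohomology` requested by route `EvenArtinGL4Door`.  For a field `F`, a
dimension `n`, a nilpotence bound `N`, an exceptional set `S` of finite places, a topological
commutative ring `T` (intended: a Hecke algebra — Scholze's `𝕋_{F,S}(K, ξ, i, m)`, the big Hecke
algebra `𝕋(K^p)_𝔪` of completed cohomology, Johansson–Newton's `\hat 𝕋` or `𝒪^+(𝒳^{red})`) and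
Hecke polynomials `P v ∈ T[X]` (intended: `scholzeHeckePolynomial n (c_{·,v})`), a term consists
of: an ideal `I ⊆ T` with `I ^ N = 0`, and an `n`-dimensional Galois determinant `D` of `F` with
values in `T ⧸ I`, continuous for the quotient topology and the Krull topology, such that
`D(1 - X Frob_v) = P_v mod I` for every finite place `v ∉ S` (all geometric Frobenii at all
primes above `v`).  This is exactly the conclusion of Scholze, Thm. V.4.1 (torsion coefficients,
`N = N([F:ℚ], n)`), resp. Cor. V.4.4 (localised at a non-Eisenstein `𝔪`, where `D` comes from a
true representation `σ_𝔪 : G_{F,S} → GL_n(𝕋_𝔪 / I)`), and of Johansson–Newton, Thm. 5.3.1 /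
Cor. 5.3.2 / Thm. B (there `I` closed, `I ^ M = 0`).  The sources give a determinant of `G_{F,S}`
(maximal extension of `F` unramified outside `S`); here it is stated over `Γ_F` with the
unramified-outside-`S` clause recorded as the field `isUnramifiedAt` (a determinant of `G_{F,S}`
pulled back to `Γ_F`; see the module docstring, §3).  The theorems asserting that those Hecke
algebras carry such a term need the completed-cohomology vocabulary (request
`defn-CompletedCohomology`) and are not vendored here.
[cite: Scholze2015, Thm. V.4.1 and Cor. V.4.4] [cite: JohanssonNewton2019, Thm. B and Cor. 5.3.2] -/
structure HeckeDeterminantCompletedCohomology (F : Type u) [Field F] (n N : ℕ)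
    (S : Set (HeightOneSpectrum (𝓞 F))) (T : Type v) [CommRing T] [TopologicalSpace T]
    (P : HeightOneSpectrum (𝓞 F) → T[X]) where
  /-- The nilpotent ideal `I ⊆ T`. -/
  ideal : Ideal T
  /-- `I ^ N = 0`. -/
  ideal_pow_eq_bot : ideal ^ N = ⊥
  /-- The `n`-dimensional determinant `D` of `Γ_F` with values in `T ⧸ I`. -/
  det : GaloisDeterminant F (T ⧸ ideal) n
  /-- `D` is continuous (`T ⧸ I` with the quotient topology, `Γ_F` with the Krull topology). -/
  isContinuous : det.IsContinuous
  /-- `D` is unramified outside `S`: at every `v ∉ S` the characteristic polynomials `D(1 - X g)`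
  are invariant under every inertia group `I_𝔓`, `𝔓 ∣ v` (`D` comes from `G_{F,S}`). -/
  isUnramifiedAt : ∀ v ∉ S, det.IsUnramifiedAt v
  /-- `D(1 - X Frob_v) = P_v mod I` for all `v ∉ S`. -/
  hasGeomFrobRevCharpolyAt : ∀ v ∉ S,
    det.HasGeomFrobRevCharpolyAt v ((P v).map (Ideal.Quotient.mk ideal))

/-- **`T` carries a Hecke determinant of dimension `n` modulo an ideal of nilpotence exponent `N`,
unramified outside `S` and matching `P` outside `S`** — the `Prop` form of
`HeckeDeterminantCompletedCohomology` (conclusion of Scholze, Thm. V.4.1 / Cor. V.4.4;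
Johansson–Newton, Thm. 5.3.1 / Cor. 5.3.2 / Thm. B).
[cite: Scholze2015, Thm. V.4.1] [cite: JohanssonNewton2019, Thm. B] -/
def HasHeckeDeterminant (F : Type u) [Field F] (n N : ℕ) (S : Set (HeightOneSpectrum (𝓞 F)))
    (T : Type v) [CommRing T] [TopologicalSpace T] (P : HeightOneSpectrum (𝓞 F) → T[X]) : Prop :=
  Nonempty (HeckeDeterminantCompletedCohomology F n N S T P)

variable {F : Type u} [Field F] {n N : ℕ} {S : Set (HeightOneSpectrum (𝓞 F))}
  {T : Type v} [CommRing T] [TopologicalSpace T] {P : HeightOneSpectrum (𝓞 F) → T[X]}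

/-- A Hecke determinant modulo `I` with `I ^ N = 0` is one modulo an ideal with `I ^ N' = 0` for
any `N' ≥ N` (weakening the nilpotence bound). [folklore] -/
def HeckeDeterminantCompletedCohomology.weaken (H : HeckeDeterminantCompletedCohomology F n N S T P)
    {N' : ℕ} (h : N ≤ N') : HeckeDeterminantCompletedCohomology F n N' S T P where
  ideal := H.ideal
  ideal_pow_eq_bot := by
    apply le_bot_iff.mp
    calc H.ideal ^ N' ≤ H.ideal ^ N := Ideal.pow_le_pow_right h
      _ = ⊥ := H.ideal_pow_eq_bot
  det := H.det
  isContinuous := H.isContinuous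
  isUnramifiedAt := H.isUnramifiedAt
  hasGeomFrobRevCharpolyAt := H.hasGeomFrobRevCharpolyAt

/-- Shrinking the set of places at which the Frobenius identity is required. [folklore] -/
def HeckeDeterminantCompletedCohomology.mono (H : HeckeDeterminantCompletedCohomology F n N S T P)
    {S' : Set (HeightOneSpectrum (𝓞 F))} (h : S ⊆ S') :
    HeckeDeterminantCompletedCohomology F n N S' T P where
  ideal := H.ideal
  ideal_pow_eq_bot := H.ideal_pow_eq_bot
  det := H.det
  isContinuous := H.isContinuous
  isUnramifiedAt v hv := H.isUnramifiedAt v fun hv' => hv (h hv')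
  hasGeomFrobRevCharpolyAt v hv := H.hasGeomFrobRevCharpolyAt v fun hv' => hv (h hv')

/-- `HasHeckeDeterminant` is monotone in the nilpotence bound and the exceptional set. [folklore] -/
theorem HasHeckeDeterminant.mono (hH : HasHeckeDeterminant F n N S T P) {N' : ℕ} (hN : N ≤ N')
    {S' : Set (HeightOneSpectrum (𝓞 F))} (hS : S ⊆ S') : HasHeckeDeterminant F n N' S' T P :=
  let ⟨H⟩ := hH; ⟨(H.weaken hN).mono hS⟩

/-- With `N = 1` the ideal is `0`. [folklore] -/
theorem HeckeDeterminantCompletedCohomology.ideal_eq_bot_of_one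
    (H : HeckeDeterminantCompletedCohomology F n 1 S T P) : H.ideal = ⊥ := by
  simpa using H.ideal_pow_eq_bot

/-- `Matrix.charpolyRev` commutes with ring homomorphisms (cf. Mathlib `Matrix.charpoly_map`).
[folklore] -/
lemma _root_.Matrix.charpolyRev_map {m : Type*} [Fintype m] [DecidableEq m] {B B' : Type*}
    [CommRing B] [CommRing B'] (M : Matrix m m B) (f : B →+* B') :
    (M.map f).charpolyRev = M.charpolyRev.map f := by
  simp only [Matrix.charpolyRev]
  rw [← Polynomial.coe_mapRingHom, RingHom.map_det, RingHom.mapMatrix_apply]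
  congr 1
  ext i j
  by_cases h : i = j
  · subst h; simp
  · simp [h]

/-- Base change along a continuous ring homomorphism preserves unramifiedness of a framed Galois
representation (`ρ σ = 1 ↦ f(1) = 1`). Ref: Serre, *Abelian ℓ-adic representations* (1968),
Ch. I §2.1. [folklore] -/
theorem FramedGaloisRep.IsUnramifiedAt.baseChange {T' : Type*} [CommRing T'] [TopologicalSpace T']
    {v : HeightOneSpectrum (𝓞 F)} {ρ : FramedGaloisRep F T n} (h : ρ.IsUnramifiedAt v)
    (f : T →+* T') (hf : Continuous f) : FramedGaloisRep.IsUnramifiedAt v (ρ.baseChange f hf) := by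
  intro 𝔓 h𝔓 σ hσ
  rw [FramedRep.baseChange_apply, h 𝔓 h𝔓 σ hσ, map_one]

/-- **A genuine representation gives a Hecke determinant with `N = 1`.**  If
`ρ : Γ_F →ₜ* GL_n(T)` is a continuous framed Galois representation, unramified outside `S`, such
that `det(1 - X ρ(σ)) = P_v` for every geometric Frobenius `σ` at every prime above every `v ∉ S`,
then `det ∘ ρ` (reduced modulo the zero ideal) is a `HeckeDeterminantCompletedCohomology F n 1 S T P`.
This is how actual representations (Scholze, Cor. V.4.2: `σ_π` over `ℚ̄_p`; Cor. V.4.4: `σ_𝔪`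
over `𝕋_𝔪 / I`, taking `T := 𝕋_𝔪 / I`) produce terms of the notion, and the non-vacuity witness.
[cite: Scholze2015, Cor. V.4.4] -/
def HeckeDeterminantCompletedCohomology.ofFramedGaloisRep [IsTopologicalRing T]
    (ρ : FramedGaloisRep F T n) (hur : ∀ v ∉ S, ρ.IsUnramifiedAt v)
    (h : ∀ v ∉ S, ∀ 𝔓 ∈ v.primesAbove, ∀ σ : absoluteGaloisGroup F, IsGeomFrobAt (𝓞 F) σ 𝔓 →
      ((ρ σ : GL (Fin n) T) : Matrix (Fin n) (Fin n) T).charpolyRev = P v) :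
    HeckeDeterminantCompletedCohomology F n 1 S T P where
  ideal := ⊥
  ideal_pow_eq_bot := pow_one _
  det := GroupDeterminant.ofFramedRep
    (FramedRep.baseChange (Ideal.Quotient.mk (⊥ : Ideal T)) (by exact continuous_quot_mk) ρ)
  isContinuous := GroupDeterminant.isContinuous_ofFramedRep _
  isUnramifiedAt v hv :=
    GaloisDeterminant.isUnramifiedAt_ofFramedRep ((hur v hv).baseChange _ _)
  hasGeomFrobRevCharpolyAt v hv 𝔓 h𝔓 σ hσ := by
    rw [GroupDeterminant.revCharpoly_ofFramedRep_of, FramedRep.baseChange_apply,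
      ← h v hv 𝔓 h𝔓 σ hσ, ← Matrix.charpolyRev_map]
    rfl

/-- Hence such a representation witnesses `HasHeckeDeterminant F n N S T P` for every `N ≥ 1`.
[cite: Scholze2015, Cor. V.4.4] -/
theorem HasHeckeDeterminant.of_framedGaloisRep [IsTopologicalRing T] (ρ : FramedGaloisRep F T n)
    (hur : ∀ v ∉ S, ρ.IsUnramifiedAt v)
    (h : ∀ v ∉ S, ∀ 𝔓 ∈ v.primesAbove, ∀ σ : absoluteGaloisGroup F, IsGeomFrobAt (𝓞 F) σ 𝔓 →
      ((ρ σ : GL (Fin n) T) : Matrix (Fin n) (Fin n) T).charpolyRev = P v) {N : ℕ} (hN : 1 ≤ N) :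
    HasHeckeDeterminant F n N S T P :=
  ⟨(HeckeDeterminantCompletedCohomology.ofFramedGaloisRep ρ hur h).weaken hN⟩

end Hecke

end Literature.NumberTheory.GaloisRepresentations
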